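import Literature.IUT.HodgeTheaters.PiAvatarBinding
import HarnessLib

/-!
# The `C_K`-side global objects in the Π-avatar binding: isomorphs of `𝒟^⊚ = ℬ(C̲_K)⁰` and the morphism
# `φ^NF_{•,v̲} : 𝒟_v̲ → 𝒟^⊚` with its factorisation through the double covering ([IUTchI] Def 4.1 (v), Ex 4.3 (ii),
# Def 6.1 (v)) — post-freeze additive D13 (NF-side kit «NFK», instance pieces for `PMBaseKit.NFKit`), not a cone member,
# not citable at 11:30Z

S. Mochizuki, *Inter-universal Teichmüller theory I*, kurims manuscript (May 2020), Definition 4.1 (v) p. 97 ("`𝒟^⊚ :=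
ℬ(C_K)⁰`"; "`†𝒟^⊚` … a category equivalent to `𝒟^⊚`"), Example 4.3 (ii) p. 99 ("the natural morphism `φ^NF_{•,v} : 𝒟_v →
𝒟^⊚` … determined by `X→_v → C_v → C_K`"), Definition 6.1 (v) p. 158 ("a finite étale double covering `𝒟^{⊚±} → 𝒟^⊚`"),
Example 6.3 (i) p. 161 (`φ^{Θell}_{•,v}` "determined by the natural composite morphism `X→_v → X_v → X_K`")
([IUTchI] Def 4.1 (v) p.97) [claim: Mochizuki2012, status: disputed] (claim key; definitions + `rfl`-level identities over
abc-iut-L5-t4's Π-avatar binding; nothing of the series is asserted, no side is taken on [IUTchIII] Cor. 3.12).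

## What this file does (HOME/staging/L5/L5-t3/NFKIT-INSTANCE-MAP.md, rows "definable now")

abc-iut-L5-t4's `PiAvatarBinding.lean` binds `𝒟^{⊚±} = ℬ(Π_{X̲_K})⁰` (`gModelObj`), `𝒟^⊚ = ℬ(Π_{C̲_K})⁰` (`gBaseObj`), the
double covering `globCover`, the isomorphs `Glob` of `𝒟^{⊚±}`, the local objects `locModelObj Gv` and `φ^{Θell}_{•,v̲}`
(`phiEllAt`) inside ONE orbit category `PiAmbient`.  For the `C_K`-side NF kit (`PMBaseKit.NFKit`, `KitNFSide.lean`) we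
add, by the SAME pattern: the isomorphs `GlobNF` of `𝒟^⊚` with the law `gnfIso`/`gnf_iso` as theorems (fields
`GlobNF`/`gnfModel`/`gnf_iso`), and `φ^NF_{•,v̲} := (xΠ_v̲ ↦ xΠ_{C̲_K})` (`phiNFAt`, field `phiNF` at good `v̲`) with the
FACTORISATION `φ^NF_{•,v̲} = φ^{Θell}_{•,v̲} ≫ (𝒟^{⊚±} → 𝒟^⊚)` (`phiNFAt_eq`, the field `phiNF_eq` at the model) — here a
theorem of the orbit category.  The functor `proj` on ALL isomorphs and the label / valuation fields are the GAP rows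
NFK-1…4 of the map (group theory of Def 3.1 (d)(e); cusps of `C̲_K`; [AbsTopIII] Thm 1.9), not attempted here.
-/

namespace Literature.IUT.HodgeTheaters

open CategoryTheory

universe u v w

section NFSide

variable {F : Type u} {K : Type v} {Fbar : Type w} [Field F] [NumberField F] [Field K]
  [NumberField K] [Algebra F K] [Field Fbar] [Algebra F Fbar] [Algebra K Fbar]
  {E : WeierstrassCurve F} [E.IsElliptic] {l : ℕ} {P : BadPlacePredicates K}
  (D : InitialThetaData F K Fbar E l P)

namespace InitialThetaData

/-! ### Isomorphs of `𝒟^⊚` (Def 4.1 (v)) -/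

/-- **Isomorphs of `𝒟^⊚`** ("`†𝒟^⊚` … a category equivalent to `𝒟^⊚`", Def 4.1 (v) p. 97): the object property of
being isomorphic, in the ambient, to `𝒟^⊚ = ℬ(Π_{C̲_K})⁰`. ([IUTchI] Def 4.1 (v) p.97) [claim: Mochizuki2012, status: disputed] -/
def IsGlobNFIsomorph : ObjectProperty D.PiAmbient := fun X => Nonempty (X ≅ D.gBaseObj)

/-- The isomorphs of `𝒟^⊚` are exactly the embedded objects of the CONJUGATES of `Π_{C̲_K}`.
([IUTchI] Def 4.1 (v) p.97) [claim: Mochizuki2012, status: disputed] -/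
theorem isGlobNFIsomorph_iff_conjugate (H : Subgroup D.PiC) :
    D.IsGlobNFIsomorph (OrbitCat.of H) ↔ ∃ a : D.PiC, ∀ x, x ∈ D.PiCund ↔ a * x * a⁻¹ ∈ H :=
  OrbitCat.nonempty_iso_iff_conjugate H D.PiCund

/-- **`GlobNF` — the category of isomorphs `†𝒟^⊚` of `𝒟^⊚` and their morphisms** (the NF-kit slot
`PMBaseKit.NFKit.GlobNF`): the full subcategory of the ambient on `IsGlobNFIsomorph`.
([IUTchI] Def 4.1 (v) p.97) [claim: Mochizuki2012, status: disputed] -/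
abbrev GlobNF : Type w := (D.IsGlobNFIsomorph).FullSubcategory

/-- `𝒟^⊚` as an object of `GlobNF` (the NF-kit slot `gnfModel`). ([IUTchI] Def 4.1 (v) p.97) [claim: Mochizuki2012, status: disputed] -/
def gnfModel : D.GlobNF := ⟨D.gBaseObj, ⟨Iso.refl _⟩⟩

/-- The underlying ambient object of `gnfModel` is `𝒟^⊚`. ([IUTchI] Def 4.1 (v) p.97) [claim: Mochizuki2012, status: disputed] -/
@[simp] theorem gnfModel_obj : (D.gnfModel).obj = D.gBaseObj := rfl

/-- Every object of `GlobNF` is an isomorph of `𝒟^⊚` (a theorem by construction).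
([IUTchI] Def 4.1 (v) p.97) [claim: Mochizuki2012, status: disputed] -/
theorem gnfIso (G : D.GlobNF) : Nonempty (G ≅ D.gnfModel) :=
  ⟨(D.IsGlobNFIsomorph).isoMk G.property.some⟩

/-- Any two objects of `GlobNF` are isomorphic (the NF-kit LAW `gnf_iso`, here a theorem).
([IUTchI] Def 4.1 (v) p.97) [claim: Mochizuki2012, status: disputed] -/
theorem gnf_iso (G H : D.GlobNF) : Nonempty (G ≅ H) :=
  ⟨(D.gnfIso G).some ≪≫ (D.gnfIso H).some.symm⟩

/-! ### `φ^NF_{•,v̲}` at good places and its factorisation through the double covering (Ex 4.3 (ii), Def 6.1 (v)) -/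

/-- `Π_v̲ ≤ Π_{C̲_K}`. ([IUTchI] Def 3.1 (f) p.63) [claim: Mochizuki2012, status: disputed] -/
theorem sub_locModelObj_le_PiCund (Gv : Subgroup (Fbar ≃ₐ[F] Fbar)) :
    D.PiXarrow ⊓ Gv.comap D.augGF ≤ D.PiCund :=
  (D.sub_locModelObj_le_PiXund Gv).trans D.PiXund_le_PiCund

/-- **`φ^NF_{•,v̲} : 𝒟_v̲ → 𝒟^⊚`** (Ex 4.3 (ii) p.99: "the natural morphism … determined by `X→_v → C_v → C_K`"): in the
Π-avatar, the morphism `xΠ_v̲ ↦ xΠ_{C̲_K}` induced by `Π_v̲ ≤ Π_{C̲_K}` (the NF-kit slot `phiNF v` at good `v̲`).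
([IUTchI] Ex 4.3 (ii) p.99) [claim: Mochizuki2012, status: disputed] -/
def phiNFAt (Gv : Subgroup (Fbar ≃ₐ[F] Fbar)) : D.locModelObj Gv ⟶ D.gBaseObj :=
  OrbitCat.homOfElem 1 (OrbitCat.one_conj_mem_of_le (D.sub_locModelObj_le_PiCund Gv))

/-- `φ^NF_{•,v̲}` is `xΠ_v̲ ↦ xΠ_{C̲_K}`. ([IUTchI] Ex 4.3 (ii) p.99) [claim: Mochizuki2012, status: disputed] -/
@[simp] theorem fn_phiNFAt (Gv : Subgroup (Fbar ≃ₐ[F] Fbar)) (x : D.PiC) :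
    OrbitCat.fn (D.phiNFAt Gv) (QuotientGroup.mk x) = QuotientGroup.mk x := by
  change OrbitCat.fn (OrbitCat.homOfElem (H := D.PiXarrow ⊓ Gv.comap D.augGF) (K := D.PiCund) (1 : D.PiC) _)
      (QuotientGroup.mk x) = QuotientGroup.mk x
  rw [OrbitCat.fn_homOfElem, mul_one]

/-- **The factorisation `φ^NF_{•,v̲} = φ^{Θell}_{•,v̲} ≫ (𝒟^{⊚±} → 𝒟^⊚)`** (`X̲→_v̲ → X̲_K → C̲_K`; the NF-kit LAW `phiNF_eq` at
the model, here a theorem of the orbit category). ([IUTchI] Def 6.1 (v) p.158) [claim: Mochizuki2012, status: disputed] -/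
theorem phiNFAt_eq (Gv : Subgroup (Fbar ≃ₐ[F] Fbar)) : D.phiNFAt Gv = D.phiEllAt Gv ≫ D.globCover := by
  apply OrbitCat.hom_ext_fn
  funext q
  induction q using QuotientGroup.induction_on with
  | H x =>
    change OrbitCat.fn (D.phiNFAt Gv) (QuotientGroup.mk x) =
      OrbitCat.fn D.globCover (OrbitCat.fn (D.phiEllAt Gv) (QuotientGroup.mk x))
    rw [fn_phiNFAt, fn_phiEllAt, fn_globCover]

/-- Uniqueness: ANY morphism `𝒟_v̲ → 𝒟^⊚` of the ambient agreeing with `φ^NF_{•,v̲}` on the base point is `φ^NF_{•,v̲}` —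
morphisms of the orbit category are determined by one value (equivariance). ([IUTchI] Ex 4.3 (ii) p.99) [claim: Mochizuki2012, status: disputed] -/
theorem phiNFAt_unique (Gv : Subgroup (Fbar ≃ₐ[F] Fbar)) (f : D.locModelObj Gv ⟶ D.gBaseObj)
    (hf : OrbitCat.fn f (QuotientGroup.mk 1) = QuotientGroup.mk 1) : f = D.phiNFAt Gv := by
  apply OrbitCat.hom_ext_fn
  funext q
  induction q using QuotientGroup.induction_on with
  | H x =>
    rw [fn_phiNFAt]
    have h := OrbitCat.fn_smul f x (QuotientGroup.mk 1)
    rw [hf] at h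
    simpa only [MulAction.Quotient.smul_mk, smul_eq_mul, mul_one] using h

end InitialThetaData

end NFSide

end Literature.IUT.HodgeTheaters
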